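import Summits.QuantumFields.BalabanUV.T4Continuum.Support.NE7FrameFreeRightInverse
import Summits.QuantumFields.BalabanUV.T4Continuum.Support.NE3BlockLineAverage
import Summits.QuantumFields.BalabanUV.T4Continuum.Support.NE3CoarseInterpolant
import Summits.QuantumFields.BalabanUV.T4Continuum.Support.NE3SlicePoincareCompetitorEnergy
import HarnessLib

/-!
# NE7FrameFreeRightInverseLetters — THE THREE ℓ-LETTERS (R1⁰), (R2⁰), (R3⁰) OF THE FRAME-FREE RIGHT INVERSE `R₀ φ = R_W φ + gaugeDir W (sfixW (framePotW (R_W φ)))`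
# (memo ROAD-G103 §7 (J1)), as COMPOSITIONS: row NE3's (R1)–(R3) for `R_W` BY NAME plus the gauge part's three sums against the two FRAME MASSES
# `Θ₂(φ) := Σ_{z∈[0,N)^d} ‖framePotW (R_W φ) z‖²`, `Θ₁(φ) := Σ_{z∈[0,N)^d} ‖framePotW (R_W φ) z‖` — DISPLAYED per `φ` (row NE7b's `NE7RightInverseFrameLetters` supplies
# `Θ₂ ≤ C·dirSq φ`, `Θ₁ ≤ C·dirL1 φ`; the instantiation is one line each and lives with the junction)

Cell `pub-balaban`, rung (B)+1 sub-cell t4, lineage `b2b-balaban-t4-ne7-p1`, generation 104 (CRUX PROVER NE7 #1 = OWNER of BINDER row NE7).  Memo `t4/b2b-balaban-t4-ne7-p1-g103/ROAD-G103.md` §6–§7.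
WHY.  The junction `hdecomp♭ ⇐ (S1)-NL0 ∧ (S2)-NL0` needs, for the normal part `Ñ⋆ = R₀ φ̃⋆` of the (R1″) representative, the letters row NE3's `rightInvW` has in
`NE3RightInverseLetters` — `dirSq Ñ ≤ c₁·(M^d∕M²)·dirSq φ`, `curlSq W Ñ ≤ c₂·(M^d∕M⁴)·dirSq φ`, `Σ_{perWin}‖curl W Ñ‖ ≤ c₃·(M^d∕M²)·dirL1 φ` (`M = L^{k+1}`, sums over `periodBox (N·M)`, data over
`periodBox N`).  `R₀ − R_W = gaugeDir W μ`, `μ = sfixW θ′`, `θ′ = framePotW (R_W φ)`: the squared-tent fix has the block letters `Σ_{[0,MN)^d}‖μ‖^q ≤ M^d(2∕tentMean2)^q Σ_{[0,N)^d}‖θ′‖^q`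
(§1), its covariant gradient the one-derivative gain `sum_normSq_gaugeDir_sfixW_le` (row NE7 gen 86), and the curl of a gauge direction is a curvature commutator (`NE3CurlOfGaugeDir`:
`‖curlAt W (gaugeDir W μ) z‖ ≤ 2x‖μ z‖`).  Hence (§2) `dirSq (gaugeDir W μ) ≤ 16d³·64^{2d}·(M^d∕M²)·Θ₂`, `curlSq W (gaugeDir W μ) ≤ 16·#Plane·64^{2d}·(M²x)²·(M^d∕M⁴)·Θ₂`,
`Σ_{perWin}‖curl W (gaugeDir W μ)‖ ≤ 4·#Plane·64^d·(M²x)·(M^d∕M²)·Θ₁`, and (§3) the letters of `R₀` by the two-term splits (`NE3SlicePoincareCompetitorEnergy.norm_add_sq_le'`).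
WHAT ([folklore]; 0 def, 0 sorry).  §1 `sum_normSq_sfixW_le`, `sum_norm_sfixW_le`; §2 `dirSq_gaugeDir_frameLift_le`, `curlSq_gaugeDir_frameLift_le`, `sum_norm_curl_gaugeDir_frameLift_le`;
§3 **`dirSq_rightInvW0_le`** (R1⁰), **`curlSq_rightInvW0_le`** (R2⁰), **`sum_norm_curl_rightInvW0_le`** (R3⁰).
HONEST FRAMING (page 1): linear kinematics of OUR objects at one background over landed kernel theorems; `Θ₂(φ)`, `Θ₁(φ)` are displayed quantities, bounded by nothing here; nothing of Bałaban's
asserted; NOT the junction, NOT NE7; spine 0∕9; finite T⁴ rung (B)+1 — NOT infinite volume, NOT mass gap, NOT BetaPertH, NOT Clay (continuum YM on T⁴ ⇐ BetaPertH ∧ nine spine estimates, 0/9 proved).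
-/

set_option autoImplicit false

open scoped BigOperators Matrix.Norms.L2Operator
open NormedSpace Finset

namespace Summit.QuantumFields.BalabanUV.T4Continuum.NE7FrameFreeRightInverseLetters

open Literature.MathematicalPhysics.QuantumFieldTheory.Balaban1983to89
open B7Prop1Explicit B7Prop2Explicit
open T4AveragingDeficitWall (IsUnitaryCfg IsSkewDir SmallField curl curlAt curlSq dirSq dirL1)
open T4AveragingDeficitWallBoundary (IsPeriodicCfg periodBox mem_periodBox card_periodBox)
open AveragingDeficitPeriodicCounting (IsPeriodicDir)
open AveragingDeficitTwoLevelPrep (prop1Radius)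
open AveragingDeficitMultiLevelPrep (LevelSmall tower)
open BlockAveragePushDirGauge (gaugeDir)
open MinimalActionLevels (perWin)
open NE3QbarIterCovLiftPrep (cruxC)
open NE3SmoothRightInverseW (rightInvW)
open NE3RightInverseSolveLetters (thetaLoc)
open NE3RightInverseL2Letter (l2C)
open NE3HatInvCurlLetters (curl2C curl1C)
open NE3RightInverseLetters (rightInvW_R1 curlSq_rightInvW_le sum_norm_curl_rightInvW_le)
open NE3TangentCovariantTower (framePotW)
open NE3CurlOfGaugeDir (norm_curlAt_gaugeDir_le curlSq_gaugeDir_le)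
open NE3SlicePoincareCompetitorEnergy (norm_add_sq_le')
open NE3EnergyHessBilin (curlAt_add)
open NE3BlockLineAverage (sum_periodBox_blocks)
open NE3CoarseInterpolant (blk_block)
open NE3TentBump (tent tent_nonneg tent_le_one)
open NE7SquaredBumpNestedMeanOperator (tentMean2 tentMean2_pos inv_le_tentMean2)
open NE7SquaredBumpNestedFix (sfixW norm_sfixW_le)
open NE7SquaredBumpGradient (sum_normSq_gaugeDir_sfixW_le)
open NE7FrameFreeRightInverse (frameLift rightInvW0)
open SmoothRefineBlocks (blk)
open SpreadLift (loopRad)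

noncomputable section

variable {d : ℕ} {n : Type*} [Fintype n] [DecidableEq n] [Nonempty n]

/-! ## §1 Block sums of the squared-tent nested-mean fix -/

section Fix

variable {L : ℕ} (hL : 2 ≤ L) (j : ℕ) {W : Site d → Fin d → (Matrix n n ℂ)ˣ} {x : ℝ}
  (hWu : IsUnitaryCfg W) (hx : 0 ≤ x) (hsm : LevelSmall d L j x) (hWx : SmallField W x)
  (hE : 4 * (d : ℝ) ^ 2 * ((L : ℝ) ^ (j + 1) - 1) ^ 2 * x + 16 * d * loopRad d L ((prop1Radius d L)^[j] x) ≤ 1 / 2)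

/-- the pointwise size read through the block: `‖sfixW θ′ (M•z + v)‖ ≤ (2∕tentMean2)·‖θ′ z‖` (`v ∈ [0,M)^d`, `tent² ≤ 1`). [folklore] -/
theorem norm_sfixW_block_le (θ' : Site d → Matrix n n ℂ) (z : Site d) {v : Site d} (hv : v ∈ periodBox (d := d) (L ^ (j + 1))) :
    ‖sfixW hL j hWu hx hsm hWx hE θ' ((((L ^ (j + 1) : ℕ) : ℤ)) • z + v)‖ ≤ 2 / tentMean2 d (L ^ (j + 1)) * ‖θ' z‖ := by
  have hM1 : 1 ≤ L ^ (j + 1) := Nat.one_le_pow _ _ (by omega)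
  have hM2 : 2 ≤ L ^ (j + 1) := le_trans hL (Nat.le_self_pow (Nat.succ_ne_zero j) L)
  have ht := tentMean2_pos hM2 d
  have h := norm_sfixW_le hL j hWu hx hsm hWx hE θ' ((((L ^ (j + 1) : ℕ) : ℤ)) • z + v)
  rw [blk_block hM1 z hv] at h
  have ht0 := tent_nonneg hM1 ((((L ^ (j + 1) : ℕ) : ℤ)) • z + v)
  have ht1 := tent_le_one hM1 ((((L ^ (j + 1) : ℕ) : ℤ)) • z + v)
  have h0 : 0 ≤ 2 / tentMean2 d (L ^ (j + 1)) * ‖θ' z‖ := by positivity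
  refine h.trans ?_
  calc tent (L ^ (j + 1)) ((((L ^ (j + 1) : ℕ) : ℤ)) • z + v) ^ 2 * (2 / tentMean2 d (L ^ (j + 1)) * ‖θ' z‖)
      ≤ 1 * (2 / tentMean2 d (L ^ (j + 1)) * ‖θ' z‖) := mul_le_mul_of_nonneg_right (pow_le_one₀ ht0 ht1) h0
    _ = _ := one_mul _

/-- **THE ℓ² BLOCK LETTER OF THE FIX**: `Σ_{y∈[0,M·N)^d} ‖sfixW θ′ y‖² ≤ M^d·(2∕tentMean2)²·Σ_{z∈[0,N)^d} ‖θ′ z‖²` (`M = L^{j+1}`). [folklore] -/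
theorem sum_normSq_sfixW_le (N : ℕ) (θ' : Site d → Matrix n n ℂ) :
    ∑ y ∈ periodBox (d := d) (L ^ (j + 1) * N), ‖sfixW hL j hWu hx hsm hWx hE θ' y‖ ^ 2
      ≤ ((L : ℝ) ^ (j + 1)) ^ d * (2 / tentMean2 d (L ^ (j + 1))) ^ 2 * ∑ z ∈ periodBox (d := d) N, ‖θ' z‖ ^ 2 := by
  have hM1 : 1 ≤ L ^ (j + 1) := Nat.one_le_pow _ _ (by omega)
  have hMR : (((L ^ (j + 1) : ℕ) : ℝ)) = (L : ℝ) ^ (j + 1) := by push_cast; ring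
  have hpt : ∀ (z : Site d) {v : Site d}, v ∈ periodBox (d := d) (L ^ (j + 1)) →
      ‖sfixW hL j hWu hx hsm hWx hE θ' ((((L ^ (j + 1) : ℕ) : ℤ)) • z + v)‖ ^ 2 ≤ (2 / tentMean2 d (L ^ (j + 1))) ^ 2 * ‖θ' z‖ ^ 2 := by
    intro z v hv
    have h := norm_sfixW_block_le hL j hWu hx hsm hWx hE θ' z hv
    calc _ ≤ (2 / tentMean2 d (L ^ (j + 1)) * ‖θ' z‖) ^ 2 := pow_le_pow_left₀ (norm_nonneg _) h 2
      _ = _ := by ring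
  calc ∑ y ∈ periodBox (d := d) (L ^ (j + 1) * N), ‖sfixW hL j hWu hx hsm hWx hE θ' y‖ ^ 2
      = ∑ z ∈ periodBox (d := d) N, ∑ v ∈ periodBox (d := d) (L ^ (j + 1)), ‖sfixW hL j hWu hx hsm hWx hE θ' ((((L ^ (j + 1) : ℕ) : ℤ)) • z + v)‖ ^ 2 := by
        rw [← sum_periodBox_blocks (L ^ (j + 1)) N hM1]
    _ ≤ ∑ z ∈ periodBox (d := d) N, ∑ _v ∈ periodBox (d := d) (L ^ (j + 1)), (2 / tentMean2 d (L ^ (j + 1))) ^ 2 * ‖θ' z‖ ^ 2 :=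
        Finset.sum_le_sum fun z _ => Finset.sum_le_sum fun v hv => hpt z hv
    _ = ((L : ℝ) ^ (j + 1)) ^ d * (2 / tentMean2 d (L ^ (j + 1))) ^ 2 * ∑ z ∈ periodBox (d := d) N, ‖θ' z‖ ^ 2 := by
        rw [Finset.mul_sum]
        refine Finset.sum_congr rfl fun z _ => ?_
        rw [Finset.sum_const, card_periodBox, nsmul_eq_mul]
        push_cast
        ring

/-- **THE ℓ¹ BLOCK LETTER OF THE FIX**: `Σ_{y∈[0,M·N)^d} ‖sfixW θ′ y‖ ≤ M^d·(2∕tentMean2)·Σ_{z∈[0,N)^d} ‖θ′ z‖`. [folklore] -/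
theorem sum_norm_sfixW_le (N : ℕ) (θ' : Site d → Matrix n n ℂ) :
    ∑ y ∈ periodBox (d := d) (L ^ (j + 1) * N), ‖sfixW hL j hWu hx hsm hWx hE θ' y‖
      ≤ ((L : ℝ) ^ (j + 1)) ^ d * (2 / tentMean2 d (L ^ (j + 1))) * ∑ z ∈ periodBox (d := d) N, ‖θ' z‖ := by
  have hM1 : 1 ≤ L ^ (j + 1) := Nat.one_le_pow _ _ (by omega)
  calc ∑ y ∈ periodBox (d := d) (L ^ (j + 1) * N), ‖sfixW hL j hWu hx hsm hWx hE θ' y‖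
      = ∑ z ∈ periodBox (d := d) N, ∑ v ∈ periodBox (d := d) (L ^ (j + 1)), ‖sfixW hL j hWu hx hsm hWx hE θ' ((((L ^ (j + 1) : ℕ) : ℤ)) • z + v)‖ := by
        rw [← sum_periodBox_blocks (L ^ (j + 1)) N hM1]
    _ ≤ ∑ z ∈ periodBox (d := d) N, ∑ _v ∈ periodBox (d := d) (L ^ (j + 1)), 2 / tentMean2 d (L ^ (j + 1)) * ‖θ' z‖ :=
        Finset.sum_le_sum fun z _ => Finset.sum_le_sum fun v hv => norm_sfixW_block_le hL j hWu hx hsm hWx hE θ' z hv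
    _ = ((L : ℝ) ^ (j + 1)) ^ d * (2 / tentMean2 d (L ^ (j + 1))) * ∑ z ∈ periodBox (d := d) N, ‖θ' z‖ := by
        rw [Finset.mul_sum]
        refine Finset.sum_congr rfl fun z _ => ?_
        rw [Finset.sum_const, card_periodBox, nsmul_eq_mul]
        push_cast
        ring

include hL in
/-- `2∕tentMean2 ≤ 2·64^d` (`M ≥ 2`). [folklore] -/
theorem two_div_tentMean2_le : 2 / tentMean2 d (L ^ (j + 1)) ≤ 2 * (64 : ℝ) ^ d := by
  have hM2 : 2 ≤ L ^ (j + 1) := le_trans hL (Nat.le_self_pow (Nat.succ_ne_zero j) L)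
  have ht := tentMean2_pos hM2 d
  have hinv := inv_le_tentMean2 hM2 d
  rw [div_le_iff₀ ht]
  have h64 : (0 : ℝ) < (64 : ℝ) ^ d := by positivity
  have : ((64 : ℝ) ^ d)⁻¹ * (64 : ℝ) ^ d = 1 := inv_mul_cancel₀ h64.ne'
  nlinarith [mul_le_mul_of_nonneg_right hinv h64.le]

end Fix

/-! ## §2 The three sums of the gauge part `gaugeDir W (frameLift φ)` against the frame masses -/

section Gauge

variable {L : ℕ} (hL : 2 ≤ L) (k : ℕ) {W : Site d → Fin d → (Matrix n n ℂ)ˣ} {x : ℝ} (hWu : IsUnitaryCfg W) (hx : 0 ≤ x) (hs : LevelSmall d L k x)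
  (hWx : SmallField W x) (N : ℕ) [NeZero N] (hθ : cruxC d L * (((L : ℝ) ^ (k + 1)) ^ 2 * x) < 1)
  (hE : 4 * (d : ℝ) ^ 2 * ((L : ℝ) ^ (k + 1) - 1) ^ 2 * x + 16 * d * loopRad d L ((prop1Radius d L)^[k] x) ≤ 1 / 2)
  {φ : Site d → Fin d → Matrix n n ℂ} (hφ : IsSkewDir φ)

/-- **THE ℓ² GRADIENT OF THE GAUGE PART**: `dirSq (gaugeDir W μ) [0,N·M)^d ≤ 16d³·64^{2d}·(M^d∕M²)·Θ₂(φ)` (`M²x ≤ 1`). [folklore] -/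
theorem dirSq_gaugeDir_frameLift_le (hd : 1 ≤ d) (hε : ((L : ℝ) ^ (k + 1)) ^ 2 * x ≤ 1) {Θ₂ : ℝ}
    (hΘ₂ : ∑ z ∈ periodBox (d := d) N, ‖framePotW L (k + 1) W (rightInvW hL k hWu hx hs hWx N hθ hφ) z‖ ^ 2 ≤ Θ₂) :
    dirSq (gaugeDir W (frameLift hL k hWu hx hs hWx N hθ hE hφ)) (periodBox (d := d) (N * L ^ (k + 1)))
      ≤ 16 * (d : ℝ) ^ 3 * ((64 : ℝ) ^ d) ^ 2 * (((L : ℝ) ^ (k + 1)) ^ d / ((L : ℝ) ^ (k + 1)) ^ 2) * Θ₂ := by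
  have hM0 : (0 : ℝ) < (L : ℝ) ^ (k + 1) := by positivity
  have hM1 : (1 : ℝ) ≤ (L : ℝ) ^ (k + 1) := one_le_pow₀ (by exact_mod_cast (by omega : 1 ≤ L))
  have hd0 : (0 : ℝ) ≤ d := Nat.cast_nonneg d
  have hΘ0 : 0 ≤ Θ₂ := le_trans (Finset.sum_nonneg fun z _ => by positivity) hΘ₂
  have h1 := sum_normSq_gaugeDir_sfixW_le hL k hWu hx hs hWx hE N (framePotW L (k + 1) W (rightInvW hL k hWu hx hs hWx N hθ hφ))
  rw [Nat.mul_comm N]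
  unfold dirSq
  refine (show _ ≤ _ from h1).trans ?_
  -- the slope `(2/M + 2(d−1)(M−1)x) ≤ 2d/M` and the profile constant `2/tentMean2 ≤ 2·64^d`
  have hslope : 2 / (L : ℝ) ^ (k + 1) + 2 * (((d : ℝ) - 1) * (((L : ℝ) ^ (k + 1)) - 1) * x) ≤ 2 * d / (L : ℝ) ^ (k + 1) := by
    rw [div_add' _ _ _ hM0.ne', div_le_div_iff_of_pos_right hM0]
    have hd1 : (1 : ℝ) ≤ d := by exact_mod_cast hd
    have h3 : (((L : ℝ) ^ (k + 1)) - 1) * x * (L : ℝ) ^ (k + 1) ≤ 1 := by nlinarith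
    nlinarith
  have hslope0 : 0 ≤ 2 / (L : ℝ) ^ (k + 1) + 2 * (((d : ℝ) - 1) * (((L : ℝ) ^ (k + 1)) - 1) * x) := by
    have hd1 : (1 : ℝ) ≤ d := by exact_mod_cast hd
    have : 0 ≤ ((d : ℝ) - 1) * (((L : ℝ) ^ (k + 1)) - 1) * x := mul_nonneg (mul_nonneg (by linarith) (by linarith)) hx
    positivity
  have hsq1 : (2 / (L : ℝ) ^ (k + 1) + 2 * (((d : ℝ) - 1) * (((L : ℝ) ^ (k + 1)) - 1) * x)) ^ 2 ≤ (2 * d / (L : ℝ) ^ (k + 1)) ^ 2 :=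
    pow_le_pow_left₀ hslope0 hslope 2
  have ht0 : 0 ≤ 2 / tentMean2 d (L ^ (k + 1)) := by
    have hM2 : 2 ≤ L ^ (k + 1) := le_trans hL (Nat.le_self_pow (Nat.succ_ne_zero k) L)
    have := tentMean2_pos hM2 d; positivity
  have hsq2 : (2 / tentMean2 d (L ^ (k + 1))) ^ 2 ≤ (2 * (64 : ℝ) ^ d) ^ 2 := pow_le_pow_left₀ ht0 (two_div_tentMean2_le hL k) 2
  have hA : (d : ℝ) * ((L : ℝ) ^ (k + 1)) ^ d * (2 / (L : ℝ) ^ (k + 1) + 2 * (((d : ℝ) - 1) * (((L : ℝ) ^ (k + 1)) - 1) * x)) ^ 2 * (2 / tentMean2 d (L ^ (k + 1))) ^ 2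
      ≤ (d : ℝ) * ((L : ℝ) ^ (k + 1)) ^ d * (2 * d / (L : ℝ) ^ (k + 1)) ^ 2 * (2 * (64 : ℝ) ^ d) ^ 2 := by
    have h0 : 0 ≤ (d : ℝ) * ((L : ℝ) ^ (k + 1)) ^ d := by positivity
    calc _ ≤ (d : ℝ) * ((L : ℝ) ^ (k + 1)) ^ d * (2 * d / (L : ℝ) ^ (k + 1)) ^ 2 * (2 / tentMean2 d (L ^ (k + 1))) ^ 2 := by
          gcongr
      _ ≤ _ := by gcongr
  have hid : (d : ℝ) * ((L : ℝ) ^ (k + 1)) ^ d * (2 * d / (L : ℝ) ^ (k + 1)) ^ 2 * (2 * (64 : ℝ) ^ d) ^ 2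
      = 16 * (d : ℝ) ^ 3 * ((64 : ℝ) ^ d) ^ 2 * (((L : ℝ) ^ (k + 1)) ^ d / ((L : ℝ) ^ (k + 1)) ^ 2) := by
    field_simp
    ring
  calc (d : ℝ) * ((L : ℝ) ^ (k + 1)) ^ d * (2 / (L : ℝ) ^ (k + 1) + 2 * (((d : ℝ) - 1) * (((L : ℝ) ^ (k + 1)) - 1) * x)) ^ 2
        * (2 / tentMean2 d (L ^ (k + 1))) ^ 2 * ∑ z ∈ periodBox (d := d) N, ‖framePotW L (k + 1) W (rightInvW hL k hWu hx hs hWx N hθ hφ) z‖ ^ 2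
      ≤ ((d : ℝ) * ((L : ℝ) ^ (k + 1)) ^ d * (2 * d / (L : ℝ) ^ (k + 1)) ^ 2 * (2 * (64 : ℝ) ^ d) ^ 2) * Θ₂ :=
        mul_le_mul hA hΘ₂ (Finset.sum_nonneg fun z _ => by positivity) (by positivity)
    _ = _ := by rw [hid]

/-- **THE CURL ENERGY OF THE GAUGE PART**: `curlSq W (gaugeDir W μ) [0,N·M)^d ≤ 16·#Plane·64^{2d}·(M²x)²·(M^d∕M⁴)·Θ₂(φ)`. [folklore] -/
theorem curlSq_gaugeDir_frameLift_le {Θ₂ : ℝ}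
    (hΘ₂ : ∑ z ∈ periodBox (d := d) N, ‖framePotW L (k + 1) W (rightInvW hL k hWu hx hs hWx N hθ hφ) z‖ ^ 2 ≤ Θ₂) :
    curlSq W (gaugeDir W (frameLift hL k hWu hx hs hWx N hθ hE hφ)) (periodBox (d := d) (N * L ^ (k + 1)))
      ≤ 16 * (Fintype.card (T4AveragingDeficitWall.Plane d) : ℝ) * ((64 : ℝ) ^ d) ^ 2 * (((L : ℝ) ^ (k + 1)) ^ 2 * x) ^ 2
          * (((L : ℝ) ^ (k + 1)) ^ d / ((L : ℝ) ^ (k + 1)) ^ 4) * Θ₂ := by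
  have hM0 : (0 : ℝ) < (L : ℝ) ^ (k + 1) := by positivity
  have hΘ0 : 0 ≤ Θ₂ := le_trans (Finset.sum_nonneg fun z _ => by positivity) hΘ₂
  have h1 := curlSq_gaugeDir_le hWu hWx (frameLift hL k hWu hx hs hWx N hθ hE hφ) (periodBox (d := d) (N * L ^ (k + 1)))
  have h2 := sum_normSq_sfixW_le hL k hWu hx hs hWx hE N (framePotW L (k + 1) W (rightInvW hL k hWu hx hs hWx N hθ hφ))
  rw [Nat.mul_comm (L ^ (k + 1)) N] at h2
  have h2' : ∑ y ∈ periodBox (d := d) (N * L ^ (k + 1)), ‖frameLift hL k hWu hx hs hWx N hθ hE hφ y‖ ^ 2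
      ≤ ((L : ℝ) ^ (k + 1)) ^ d * (2 * (64 : ℝ) ^ d) ^ 2 * Θ₂ := by
    have ht0 : 0 ≤ 2 / tentMean2 d (L ^ (k + 1)) := by
      have hM2 : 2 ≤ L ^ (k + 1) := le_trans hL (Nat.le_self_pow (Nat.succ_ne_zero k) L)
      have := tentMean2_pos hM2 d; positivity
    have hsq2 : (2 / tentMean2 d (L ^ (k + 1))) ^ 2 ≤ (2 * (64 : ℝ) ^ d) ^ 2 := pow_le_pow_left₀ ht0 (two_div_tentMean2_le hL k) 2
    refine (show _ ≤ _ from h2).trans ?_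
    exact mul_le_mul (mul_le_mul_of_nonneg_left hsq2 (by positivity)) hΘ₂ (Finset.sum_nonneg fun z _ => by positivity) (by positivity)
  refine h1.trans ?_
  have hP : 0 ≤ 4 * x ^ 2 * (Fintype.card (T4AveragingDeficitWall.Plane d) : ℝ) := by positivity
  refine (mul_le_mul_of_nonneg_left h2' hP).trans (le_of_eq ?_)
  field_simp
  ring

/-- **THE ℓ¹ CURL OF THE GAUGE PART**: `Σ_{p∈perWin d (N·M)} ‖curl W (gaugeDir W μ) p‖ ≤ 4·#Plane·64^d·(M²x)·(M^d∕M²)·Θ₁(φ)`. [folklore] -/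
theorem sum_norm_curl_gaugeDir_frameLift_le {Θ₁ : ℝ}
    (hΘ₁ : ∑ z ∈ periodBox (d := d) N, ‖framePotW L (k + 1) W (rightInvW hL k hWu hx hs hWx N hθ hφ) z‖ ≤ Θ₁) :
    ∑ p ∈ perWin d (N * L ^ (k + 1)), ‖curl W (gaugeDir W (frameLift hL k hWu hx hs hWx N hθ hE hφ)) p‖
      ≤ 4 * (Fintype.card (T4AveragingDeficitWall.Plane d) : ℝ) * (64 : ℝ) ^ d * (((L : ℝ) ^ (k + 1)) ^ 2 * x)
          * (((L : ℝ) ^ (k + 1)) ^ d / ((L : ℝ) ^ (k + 1)) ^ 2) * Θ₁ := by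
  have hM0 : (0 : ℝ) < (L : ℝ) ^ (k + 1) := by positivity
  have hΘ0 : 0 ≤ Θ₁ := le_trans (Finset.sum_nonneg fun z _ => by positivity) hΘ₁
  set μ := frameLift hL k hWu hx hs hWx N hθ hE hφ with hμ
  -- pointwise: `‖curl W (gaugeDir W μ) (y, π)‖ ≤ 2x‖μ y‖`
  have hpt : ∀ (y : Site d) (π : T4AveragingDeficitWall.Plane d), ‖curl W (gaugeDir W μ) (y, π)‖ ≤ 2 * x * ‖μ y‖ := fun y π =>
    norm_curlAt_gaugeDir_le hWu hWx μ y (ne_of_lt π.2)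
  have hsum : ∑ p ∈ perWin d (N * L ^ (k + 1)), ‖curl W (gaugeDir W μ) p‖
      ≤ 2 * x * (Fintype.card (T4AveragingDeficitWall.Plane d) : ℝ) * ∑ y ∈ periodBox (d := d) (N * L ^ (k + 1)), ‖μ y‖ := by
    unfold perWin
    rw [Finset.sum_product, Finset.mul_sum]
    refine Finset.sum_le_sum fun y _ => ?_
    calc ∑ π : T4AveragingDeficitWall.Plane d, ‖curl W (gaugeDir W μ) (y, π)‖ ≤ ∑ _π : T4AveragingDeficitWall.Plane d, 2 * x * ‖μ y‖ :=
          Finset.sum_le_sum fun π _ => hpt y π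
      _ = 2 * x * (Fintype.card (T4AveragingDeficitWall.Plane d) : ℝ) * ‖μ y‖ := by rw [Finset.sum_const, Finset.card_univ, nsmul_eq_mul]; ring
  have h2 := sum_norm_sfixW_le hL k hWu hx hs hWx hE N (framePotW L (k + 1) W (rightInvW hL k hWu hx hs hWx N hθ hφ))
  rw [Nat.mul_comm (L ^ (k + 1)) N] at h2
  have h2' : ∑ y ∈ periodBox (d := d) (N * L ^ (k + 1)), ‖μ y‖ ≤ ((L : ℝ) ^ (k + 1)) ^ d * (2 * (64 : ℝ) ^ d) * Θ₁ := by
    refine (show _ ≤ _ from h2).trans ?_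
    exact mul_le_mul (mul_le_mul_of_nonneg_left (two_div_tentMean2_le hL k) (by positivity)) hΘ₁ (Finset.sum_nonneg fun z _ => by positivity) (by positivity)
  refine hsum.trans ?_
  have hP : 0 ≤ 2 * x * (Fintype.card (T4AveragingDeficitWall.Plane d) : ℝ) := by positivity
  refine (mul_le_mul_of_nonneg_left h2' hP).trans (le_of_eq ?_)
  field_simp
  ring

end Gauge

/-! ## §3 The three ℓ-letters of `R₀` -/

section RightInverse

variable {L : ℕ} (hL : 2 ≤ L) (k : ℕ) {W : Site d → Fin d → (Matrix n n ℂ)ˣ} {x : ℝ} (hWu : IsUnitaryCfg W) (hx : 0 ≤ x) (hs : LevelSmall d L k x)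
  (hWx : SmallField W x) (N : ℕ) [NeZero N] (hθ : cruxC d L * (((L : ℝ) ^ (k + 1)) ^ 2 * x) < 1)
  (hE : 4 * (d : ℝ) ^ 2 * ((L : ℝ) ^ (k + 1) - 1) ^ 2 * x + 16 * d * loopRad d L ((prop1Radius d L)^[k] x) ≤ 1 / 2)
  (hWP : IsPeriodicCfg W ((tower L N (k + 1) : ℕ) : ℤ)) (hθl : thetaLoc d L * (((L : ℝ) ^ (k + 1)) ^ 2 * x) < 1) (hε : ((L : ℝ) ^ (k + 1)) ^ 2 * x ≤ 1)
  {φ : Site d → Fin d → Matrix n n ℂ} (hφ : IsSkewDir φ)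

include hWP hθl hε in
/-- **(R1⁰) — THE ℓ² LETTER OF `R₀`**: `dirSq (R₀ φ) [0,N·M)^d ≤ 2·(l2C∕(1−θ_loc)²)·(M^d∕M²)·dirSq φ [0,N)^d + 2·16d³·64^{2d}·(M^d∕M²)·Θ₂(φ)`. [folklore] -/
theorem dirSq_rightInvW0_le (hd : 1 ≤ d) {Θ₂ : ℝ}
    (hΘ₂ : ∑ z ∈ periodBox (d := d) N, ‖framePotW L (k + 1) W (rightInvW hL k hWu hx hs hWx N hθ hφ) z‖ ^ 2 ≤ Θ₂) :
    dirSq (rightInvW0 hL k hWu hx hs hWx N hθ hE hφ) (periodBox (d := d) (N * L ^ (k + 1)))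
      ≤ 2 * ((l2C d L / (1 - thetaLoc d L * (((L : ℝ) ^ (k + 1)) ^ 2 * x)) ^ 2) * (((L : ℝ) ^ (k + 1)) ^ d / ((L : ℝ) ^ (k + 1)) ^ 2) * dirSq φ (periodBox (d := d) N))
        + 2 * (16 * (d : ℝ) ^ 3 * ((64 : ℝ) ^ d) ^ 2 * (((L : ℝ) ^ (k + 1)) ^ d / ((L : ℝ) ^ (k + 1)) ^ 2) * Θ₂) := by
  have hR := rightInvW_R1 hL k hWu hWP hx hs hWx hθ hθl hε hφ
  have hG := dirSq_gaugeDir_frameLift_le hL k hWu hx hs hWx N hθ hE hφ hd hε hΘ₂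
  have hsplit : dirSq (rightInvW0 hL k hWu hx hs hWx N hθ hE hφ) (periodBox (d := d) (N * L ^ (k + 1)))
      ≤ 2 * dirSq (rightInvW hL k hWu hx hs hWx N hθ hφ) (periodBox (d := d) (N * L ^ (k + 1)))
        + 2 * dirSq (gaugeDir W (frameLift hL k hWu hx hs hWx N hθ hE hφ)) (periodBox (d := d) (N * L ^ (k + 1))) := by
    unfold dirSq
    rw [Finset.mul_sum, Finset.mul_sum, ← Finset.sum_add_distrib]
    refine Finset.sum_le_sum fun y _ => ?_
    rw [Finset.mul_sum, Finset.mul_sum, ← Finset.sum_add_distrib]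
    refine Finset.sum_le_sum fun ν _ => ?_
    exact norm_add_sq_le' _ _
  linarith

include hWP hθl hε in
/-- **(R2⁰) — THE CURL-ENERGY LETTER OF `R₀`**: `curlSq W (R₀ φ) [0,N·M)^d ≤ 2·(curl2C∕(1−θ_loc)²)·(M^d∕M⁴)·dirSq φ [0,N)^d + 2·16·#Plane·64^{2d}·(M²x)²·(M^d∕M⁴)·Θ₂(φ)`. [folklore] -/
theorem curlSq_rightInvW0_le {Θ₂ : ℝ}
    (hΘ₂ : ∑ z ∈ periodBox (d := d) N, ‖framePotW L (k + 1) W (rightInvW hL k hWu hx hs hWx N hθ hφ) z‖ ^ 2 ≤ Θ₂) :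
    curlSq W (rightInvW0 hL k hWu hx hs hWx N hθ hE hφ) (periodBox (d := d) (N * L ^ (k + 1)))
      ≤ 2 * ((curl2C d L / (1 - thetaLoc d L * (((L : ℝ) ^ (k + 1)) ^ 2 * x)) ^ 2) * (((L : ℝ) ^ (k + 1)) ^ d / ((L : ℝ) ^ (k + 1)) ^ 4) * dirSq φ (periodBox (d := d) N))
        + 2 * (16 * (Fintype.card (T4AveragingDeficitWall.Plane d) : ℝ) * ((64 : ℝ) ^ d) ^ 2 * (((L : ℝ) ^ (k + 1)) ^ 2 * x) ^ 2
            * (((L : ℝ) ^ (k + 1)) ^ d / ((L : ℝ) ^ (k + 1)) ^ 4) * Θ₂) := by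
  have hR := curlSq_rightInvW_le hL k hWu hWP hx hs hWx hθ hθl hε hφ
  have hG := curlSq_gaugeDir_frameLift_le hL k hWu hx hs hWx N hθ hE hφ hΘ₂
  have e : rightInvW0 hL k hWu hx hs hWx N hθ hE hφ = rightInvW hL k hWu hx hs hWx N hθ hφ + gaugeDir W (frameLift hL k hWu hx hs hWx N hθ hE hφ) := by
    funext y κ; rfl
  have hsplit : curlSq W (rightInvW0 hL k hWu hx hs hWx N hθ hE hφ) (periodBox (d := d) (N * L ^ (k + 1)))
      ≤ 2 * curlSq W (rightInvW hL k hWu hx hs hWx N hθ hφ) (periodBox (d := d) (N * L ^ (k + 1)))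
        + 2 * curlSq W (gaugeDir W (frameLift hL k hWu hx hs hWx N hθ hE hφ)) (periodBox (d := d) (N * L ^ (k + 1))) := by
    rw [e]
    unfold curlSq
    rw [Finset.mul_sum, Finset.mul_sum, ← Finset.sum_add_distrib]
    refine Finset.sum_le_sum fun y _ => ?_
    rw [Finset.mul_sum, Finset.mul_sum, ← Finset.sum_add_distrib]
    refine Finset.sum_le_sum fun π _ => ?_
    show ‖curlAt W (rightInvW hL k hWu hx hs hWx N hθ hφ + gaugeDir W (frameLift hL k hWu hx hs hWx N hθ hE hφ)) y π.1.1 π.1.2‖ ^ 2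
      ≤ 2 * ‖curlAt W (rightInvW hL k hWu hx hs hWx N hθ hφ) y π.1.1 π.1.2‖ ^ 2 + 2 * ‖curlAt W (gaugeDir W (frameLift hL k hWu hx hs hWx N hθ hE hφ)) y π.1.1 π.1.2‖ ^ 2
    rw [curlAt_add]
    exact norm_add_sq_le' _ _
  linarith

include hWP hθl hε in
/-- **(R3⁰) — THE ℓ¹ CURL LETTER OF `R₀`**: `Σ_{p∈perWin d (N·M)} ‖curl W (R₀ φ) p‖ ≤ (curl1C∕(1−θ_loc))·(M^d∕M²)·dirL1 φ [0,N)^d + 4·#Plane·64^d·(M²x)·(M^d∕M²)·Θ₁(φ)`. [folklore] -/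
theorem sum_norm_curl_rightInvW0_le {Θ₁ : ℝ}
    (hΘ₁ : ∑ z ∈ periodBox (d := d) N, ‖framePotW L (k + 1) W (rightInvW hL k hWu hx hs hWx N hθ hφ) z‖ ≤ Θ₁) :
    ∑ p ∈ perWin d (N * L ^ (k + 1)), ‖curl W (rightInvW0 hL k hWu hx hs hWx N hθ hE hφ) p‖
      ≤ (curl1C d L / (1 - thetaLoc d L * (((L : ℝ) ^ (k + 1)) ^ 2 * x))) * (((L : ℝ) ^ (k + 1)) ^ d / ((L : ℝ) ^ (k + 1)) ^ 2) * dirL1 φ (periodBox (d := d) N)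
        + 4 * (Fintype.card (T4AveragingDeficitWall.Plane d) : ℝ) * (64 : ℝ) ^ d * (((L : ℝ) ^ (k + 1)) ^ 2 * x)
            * (((L : ℝ) ^ (k + 1)) ^ d / ((L : ℝ) ^ (k + 1)) ^ 2) * Θ₁ := by
  have hR := sum_norm_curl_rightInvW_le hL k hWu hWP hx hs hWx hθ hθl hε hφ
  have hG := sum_norm_curl_gaugeDir_frameLift_le hL k hWu hx hs hWx N hθ hE hφ hΘ₁
  have e : rightInvW0 hL k hWu hx hs hWx N hθ hE hφ = rightInvW hL k hWu hx hs hWx N hθ hφ + gaugeDir W (frameLift hL k hWu hx hs hWx N hθ hE hφ) := by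
    funext y κ; rfl
  have hsplit : ∑ p ∈ perWin d (N * L ^ (k + 1)), ‖curl W (rightInvW0 hL k hWu hx hs hWx N hθ hE hφ) p‖
      ≤ ∑ p ∈ perWin d (N * L ^ (k + 1)), ‖curl W (rightInvW hL k hWu hx hs hWx N hθ hφ) p‖
        + ∑ p ∈ perWin d (N * L ^ (k + 1)), ‖curl W (gaugeDir W (frameLift hL k hWu hx hs hWx N hθ hE hφ)) p‖ := by
    rw [e, ← Finset.sum_add_distrib]
    refine Finset.sum_le_sum fun p _ => ?_
    show ‖curlAt W (rightInvW hL k hWu hx hs hWx N hθ hφ + gaugeDir W (frameLift hL k hWu hx hs hWx N hθ hE hφ)) p.1 p.2.1.1 p.2.1.2‖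
      ≤ ‖curlAt W (rightInvW hL k hWu hx hs hWx N hθ hφ) p.1 p.2.1.1 p.2.1.2‖ + ‖curlAt W (gaugeDir W (frameLift hL k hWu hx hs hWx N hθ hE hφ)) p.1 p.2.1.1 p.2.1.2‖
    rw [curlAt_add]
    exact norm_add_le _ _
  linarith

end RightInverse

end

end Summit.QuantumFields.BalabanUV.T4Continuum.NE7FrameFreeRightInverseLetters
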